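import Mathlib.Analysis.Calculus.BumpFunction.Convolution
import Mathlib.Analysis.Calculus.ContDiff.Convolution
import Mathlib.Analysis.Distribution.AEEqOfIntegralContDiff
import Literature.Analysis.FluidPDE.LocalLerayInitialEnergy
import Literature.Analysis.FluidPDE.CaloricRemainderCalculus
import HarnessLib

/-!
# A distribution on a slab with vanishing spatial gradient is a function of time

Analysis/FluidPDE proofs file (theorems only, no new definitions, no new named facts), part of
the proof of the named fact `Literature.Analysis.FluidPDE.jia_sverak_2014_theorem_3_2`
(`JiaSverak2014LocalRegularity.lean`; H. Jia, V. Šverák, Invent. Math. 196 (2014) =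
arXiv:1204.0529, §3 Thm. 3.2). In the proof of Thm. 3.1 (arXiv p. 8) the pressure `q` of the
perturbation `v = u - a` is `p - π_a` for *the* pressure of the regular flow `a`; the tree's
mild-solution theory offers two pressures for `a` — the local Leray pressure of the Kato solution
(Lemarié-Rieusset 2016, Thm. 15.1 (A), `kato_isLocalLeraySolutionOn_holds`) and the classical
pressure of the smooth representative (`mild_L3_smooth_holds`) — and the printed argument uses
both properties (integrability up to `t = 0` and the pointwise equations). They agree up to a
function of time: "we can change the pressure by any function depending on `t` only"
(Rusin–Šverák 2011, §2 p. 4; Jia–Šverák 2013, Remark after (2.6); the gauge `c_{x₀}(t)` of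
Jia–Šverák 2014, §3 (3.3)). This file proves the underlying distributional fact:

* `ae_exists_const_of_forall_integral_mul_fderiv_eq_zero` — if `F` is locally integrable on the
  slab `(T₁,T₂) × E` and `∫∫ F ∂ₑθ = 0` for all scalar space–time test functions `θ` on the slab
  and all directions `e`, then for a.e. `t`, `F(t, ·)` is a.e. constant (du Bois-Reymond in `t`
  for the sliced pairings against a countable family of mollifier bumps; on a good slice the
  mollified functions `F(t) ⋆ φ_n` have zero derivative, hence are constant, and tend to `F(t)`
  a.e., Mathlib's `ContDiffBump.ae_convolution_tendsto_right_of_locallyIntegrable`);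
* `ae_exists_const_of_forall_integral_mul_divergence_eq_zero` — the same from
  `∫∫ F div ψ = 0` for all vector test fields `ψ` (take `ψ = θ e`);
* `exists_measurable_gauge_of_forall_integral_mul_divergence_eq_zero` — a measurable `c` with
  `F(t, x) = c(t)` for a.e. `(t, x)`.

## Mathlib / tree search

Mathlib: `IsOpen.ae_eq_zero_of_integral_contDiff_smul_eq_zero` (du Bois-Reymond),
`ContDiffBump`, `ContDiffBump.normed`, `ContDiffBump.ae_convolution_tendsto_right_of_locallyIntegrable`,
`HasCompactSupport.hasFDerivAt_convolution_right`, `convolution_precompR_apply`,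
`HasCompactSupport.continuous_convolution_left`, `convolution_eq_swap`, `is_const_of_fderiv_eq_zero`,
`TopologicalSpace.denseSeq`, `Integrable.prod_right_ae`, `Measure.ae_prod_mem_iff_ae_ae_mem`.
Tree: `isSpaceTimeTestOn_prod_mul`, `divergence_eq_sum_inner_fderiv`, `IsSpaceTimeTestOn`
(`lean search 'up_to.*time|function of time|pressure_unique'`: only the torus statement of
uniqueness of the pressure up to constants inside specific files).

## References

* H. Jia, V. Šverák, Invent. Math. 196 (2014) = arXiv:1204.0529, §3 (3.3) and proof of Thm. 3.1
  (p. 8). Bib key `JiaSverak2014`.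
* W. Rusin, V. Šverák, J. Funct. Anal. 260 (2011) = arXiv:0911.0500, §2 p. 4. Bib key
  `RusinSverak2011`.
-/

noncomputable section

open MeasureTheory TopologicalSpace Set Function Filter Metric ContinuousLinearMap
open _root_.Topology
open scoped ENNReal NNReal RealInnerProductSpace Convolution

namespace Literature.Analysis.FluidPDE

variable {E : Type*} [NormedAddCommGroup E] [InnerProductSpace ℝ E] [FiniteDimensional ℝ E]
  [MeasurableSpace E] [BorelSpace E]

/-! ### Calculus of the test fields `θ e` and of reflected bumps -/

omit [MeasurableSpace E] [BorelSpace E] in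
/-- The divergence of `x ↦ g(x) e` is the directional derivative `∂ₑ g`. [folklore] -/
theorem divergence_smul_const_eq_fderiv_apply {g : E → ℝ} {x : E} (hg : DifferentiableAt ℝ g x) (e : E) :
    VectorCalculus.divergence (fun y => g y • e) x = fderiv ℝ g x e := by
  set b := stdOrthonormalBasis ℝ E with hb
  rw [divergence_eq_sum_inner_fderiv b]
  have hD : fderiv ℝ (fun y => g y • e) x = (fderiv ℝ g x).smulRight e :=
    (hg.hasFDerivAt.smul_const e).fderiv
  simp only [hD, ContinuousLinearMap.smulRight_apply, inner_smul_right]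
  calc ∑ i, fderiv ℝ g x (b i) * ⟪b i, e⟫ = fderiv ℝ g x (∑ i, ⟪b i, e⟫ • b i) := by
        rw [map_sum]
        refine Finset.sum_congr rfl fun i _ => ?_
        rw [map_smul, smul_eq_mul, mul_comm]
    _ = fderiv ℝ g x e := by rw [b.sum_repr' e]

omit [FiniteDimensional ℝ E] [MeasurableSpace E] [BorelSpace E] in
/-- Derivative of the reflected function `y ↦ ρ (c - y)`: `∂ₑ[ρ(c - ·)](y) = -∂ₑρ(c - y)`. [folklore] -/
theorem fderiv_reflect_sub_apply {ρ : E → ℝ} (hρ : Differentiable ℝ ρ) (c y e : E) :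
    fderiv ℝ (fun y => ρ (c - y)) y e = -fderiv ℝ ρ (c - y) e := by
  have h : HasFDerivAt (fun y => ρ (c - y)) ((fderiv ℝ ρ (c - y)).comp (-ContinuousLinearMap.id ℝ E)) y := by
    have h1 : HasFDerivAt (fun y : E => c - y) (-ContinuousLinearMap.id ℝ E) y :=
      (hasFDerivAt_id y).const_sub c
    exact (hρ (c - y)).hasFDerivAt.comp y h1
  rw [h.fderiv]
  simp

/-! ### The main lemma -/

set_option maxHeartbeats 1600000 in
/-- **A locally integrable function on a slab whose distributional spatial gradient vanishes is
a.e. constant on a.e. time slice.** Let `F` be locally integrable on `(T₁,T₂) × E` and suppose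
`∫∫ F(t,x) ∂ₑθ(t,x) = 0` for every scalar space–time test function `θ` on the slab and every
direction `e`. Then for a.e. `t ∈ (T₁,T₂)` there is a constant `κ(t)` with `F(t, x) = κ(t)` for
a.e. `x`. Proof: testing with `θ(t,x) = η(t) φ_n(q_k - x)` (`φ_n` normalised bumps of radius
`→ 0`, `q_k` a dense sequence) and du Bois-Reymond in `t` give, for a.e. `t`, the vanishing of
the sliced pairings for all `n, k, e`; by continuity in the centre they vanish for all centres,
i.e. `∇(F(t) ⋆ φ_n) = 0`, so `F(t) ⋆ φ_n` is constant; and `F(t) ⋆ φ_n → F(t)` a.e.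
(Rusin–Šverák 2011, §2 p. 4: "we can change the pressure by any function depending on `t`
only" — the converse uniqueness statement.) [cite: RusinSverak2011, §2 p. 4] -/
theorem ae_exists_const_of_forall_integral_mul_fderiv_eq_zero {T₁ T₂ : ℝ} {F : ℝ → E → ℝ}
    (hF : LocallyIntegrableOn (uncurry F) (Ioo T₁ T₂ ×ˢ (univ : Set E)) volume)
    (h : ∀ θ : ℝ → E → ℝ, IsSpaceTimeTestOn (slab E (Ioo T₁ T₂) isOpen_Ioo) θ → ∀ e : E,
      ∫ z in Ioo T₁ T₂ ×ˢ (univ : Set E), F z.1 z.2 * fderiv ℝ (θ z.1) z.2 e = 0) :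
    ∀ᵐ t ∂(volume.restrict (Ioo T₁ T₂)), ∃ κ : ℝ, ∀ᵐ x ∂(volume : Measure E), F t x = κ := by
  haveI : Nonempty E := ⟨0⟩
  set S : Set ℝ := Ioo T₁ T₂ with hS
  -- ## the countable family of bumps and centres
  obtain ⟨φ, hφout, hφin⟩ : ∃ φ : ℕ → ContDiffBump (0 : E),
      (∀ n, (φ n).rOut = 1 / ((n : ℝ) + 1)) ∧ ∀ n, (φ n).rIn = 1 / (2 * ((n : ℝ) + 1)) :=
    ⟨fun n => ⟨(1 : ℝ) / (2 * ((n : ℝ) + 1)), 1 / ((n : ℝ) + 1), by positivity,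
      by rw [div_lt_div_iff_of_pos_left one_pos (by positivity) (by positivity)]; linarith⟩,
      fun n => rfl, fun n => rfl⟩
  have hφ0 : Tendsto (fun n => (φ n).rOut) atTop (𝓝 0) := by
    simp only [hφout]; exact tendsto_one_div_add_atTop_nhds_zero_nat
  have hφ2 : ∀ n, (φ n).rOut ≤ 2 * (φ n).rIn := fun n => by
    rw [hφout, hφin]; apply le_of_eq; field_simp
  set ρ : ℕ → E → ℝ := fun n => (φ n).normed (volume : Measure E) with hρ
  have hρs : ∀ n, ContDiff ℝ (⊤ : ℕ∞) (ρ n) := fun n => (φ n).contDiff_normed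
  have hρc : ∀ n, HasCompactSupport (ρ n) := fun n => (φ n).hasCompactSupport_normed
  have hρd : ∀ n, Differentiable ℝ (ρ n) := fun n => (hρs n).differentiable (by simp)
  set q : ℕ → E := denseSeq E with hq
  set b := stdOrthonormalBasis ℝ E with hb
  -- the derivative fields `D n e y = ∂ₑ ρ_n (y)` (continuous, compactly supported)
  have hDc : ∀ n (e : E), Continuous fun y => fderiv ℝ (ρ n) y e := fun n e =>
    ((hρs n).continuous_fderiv (by simp)).clm_apply continuous_const
  have hDcs : ∀ n (e : E), HasCompactSupport fun y => fderiv ℝ (ρ n) y e := fun n e =>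
    (hρc n).fderiv_apply (𝕜 := ℝ) e
  obtain ⟨CD, hCD⟩ : ∃ C : ℕ → E → ℝ, ∀ n e y, ‖fderiv ℝ (ρ n) y e‖ ≤ C n e := by
    refine ⟨fun n e => Classical.choose ((hDc n e).bounded_above_of_compact_support (hDcs n e)), ?_⟩
    intro n e y
    exact Classical.choose_spec ((hDc n e).bounded_above_of_compact_support (hDcs n e)) y
  -- ## Step 1: the sliced pairings `g(t) = ∫ F(t,y) ∂ₑρ_n(c - y) dy` vanish a.e. for each `(n, c, e)`
  have hstep1 : ∀ (n : ℕ) (c e : E), ∀ᵐ t ∂(volume : Measure ℝ), t ∈ S →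
      ∫ y, F t y * fderiv ℝ (ρ n) (c - y) e = 0 := by
    intro n c e
    -- the reflected bump and its pairing field
    set ψ : E → ℝ := fun y => fderiv ℝ (ρ n) (c - y) e with hψ
    have hψc : Continuous ψ := (hDc n e).comp (continuous_const.sub continuous_id)
    have hψcs : HasCompactSupport ψ := (hDcs n e).comp_homeomorph (Homeomorph.subLeft c)
    have hψb : ∀ y, ‖ψ y‖ ≤ CD n e := fun y => hCD n e (c - y)
    -- the sliced pairing
    set g : ℝ → ℝ := fun t => ∫ y, F t y * ψ y with hg
    -- integrability of `η(t) F ψ` on `ℝ × E` for a bounded measurable `η` vanishing off a compact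
    -- interval `[a', b'] ⊆ S`
    have hFψ : ∀ {a' b' : ℝ}, Icc a' b' ⊆ S → ∀ {η : ℝ → ℝ}, Measurable η → (∀ t ∉ Icc a' b', η t = 0) →
        ∀ {C : ℝ}, (∀ t, ‖η t‖ ≤ C) →
        Integrable (fun z : ℝ × E => η z.1 * (F z.1 z.2 * ψ z.2)) (volume : Measure (ℝ × E)) := by
      intro a' b' hJ η hηm hη0 C hηC
      have hK : IsCompact (Icc a' b' ×ˢ tsupport ψ) := isCompact_Icc.prod hψcs
      have hKS : Icc a' b' ×ˢ tsupport ψ ⊆ S ×ˢ (univ : Set E) := prod_mono hJ (subset_univ _)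
      have hI : IntegrableOn (uncurry F) (Icc a' b' ×ˢ tsupport ψ) volume := hF.integrableOn_compact_subset hKS hK
      have h1 : IntegrableOn (fun z : ℝ × E => η z.1 * (F z.1 z.2 * ψ z.2)) (Icc a' b' ×ˢ tsupport ψ) volume := by
        have h0 : IntegrableOn (fun z : ℝ × E => F z.1 z.2 * ψ z.2) (Icc a' b' ×ˢ tsupport ψ) volume :=
          Integrable.mul_bdd (c := CD n e) hI (hψc.comp continuous_snd).aestronglyMeasurable
            (Eventually.of_forall fun z => hψb z.2)
        exact Integrable.bdd_mul (c := C) h0 ((hηm.comp measurable_fst).aestronglyMeasurable)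
          (Eventually.of_forall fun z => hηC z.1)
      refine h1.integrable_of_forall_notMem_eq_zero fun z hz => ?_
      rcases not_and_or.1 (fun h' => hz (mem_prod.2 h')) with h' | h'
      · rw [hη0 z.1 h', zero_mul]
      · rw [show ψ z.2 = 0 from image_eq_zero_of_notMem_tsupport h', mul_zero, mul_zero]
    -- a compact subset of the open interval `S` lies in a compact subinterval
    have hsubint : ∀ {J : Set ℝ}, J ⊆ S → IsCompact J → ∃ a' b', J ⊆ Icc a' b' ∧ Icc a' b' ⊆ S := by
      intro J hJ hJc
      rcases J.eq_empty_or_nonempty with hJe | hJne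
      · rcases (Ioo T₁ T₂).eq_empty_or_nonempty with hSe | ⟨m, hm⟩
        · refine ⟨1, 0, by rw [hJe]; exact empty_subset _, ?_⟩
          rw [Icc_eq_empty (by norm_num)]; exact empty_subset _
        · exact ⟨m, m, by rw [hJe]; exact empty_subset _, by rw [Icc_self]; exact singleton_subset_iff.2 hm⟩
      · refine ⟨sInf J, sSup J, fun x hx => ⟨csInf_le hJc.bddBelow hx, le_csSup hJc.bddAbove hx⟩, ?_⟩
        exact (ordConnected_Ioo.out (hJ (hJc.sInf_mem hJne)) (hJ (hJc.sSup_mem hJne)))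
    -- local integrability of `g` on `S`
    have hgloc : LocallyIntegrableOn g S volume := by
      refine (locallyIntegrableOn_iff isOpen_Ioo.isLocallyClosed).2 fun J hJ hJc => ?_
      obtain ⟨a', b', hJI, hIS⟩ := hsubint hJ hJc
      refine IntegrableOn.mono_set ?_ hJI
      have hI := hFψ hIS (measurable_const.indicator measurableSet_Icc : Measurable ((Icc a' b').indicator fun _ => (1 : ℝ)))
        (fun t ht => indicator_of_notMem ht _) (C := 1) (fun t => by
          by_cases ht : t ∈ Icc a' b'
          · rw [indicator_of_mem ht, norm_one]
          · rw [indicator_of_notMem ht, norm_zero]; exact zero_le_one)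
      have hI' : Integrable (fun z : ℝ × E => (Icc a' b').indicator (fun _ => (1 : ℝ)) z.1 * (F z.1 z.2 * ψ z.2))
          ((volume : Measure ℝ).prod (volume : Measure E)) := by rw [← Measure.volume_eq_prod]; exact hI
      have h2 := hI'.integral_prod_left
      have h3 : (fun t => ∫ y, (Icc a' b').indicator (fun _ => (1 : ℝ)) t * (F t y * ψ y)) =
          (Icc a' b').indicator g := by
        funext t
        by_cases ht : t ∈ Icc a' b'
        · simp only [indicator_of_mem ht, one_mul, hg]
        · simp only [indicator_of_notMem ht, zero_mul, integral_zero]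
      rw [h3, integrable_indicator_iff measurableSet_Icc] at h2
      exact h2
    -- du Bois-Reymond in `t`
    have hdBR : ∀ᵐ t ∂(volume : Measure ℝ), t ∈ S → g t = 0 := by
      refine isOpen_Ioo.ae_eq_zero_of_integral_contDiff_smul_eq_zero hgloc fun η hη hηc hηS => ?_
      obtain ⟨a', b', hKI, hIS⟩ := hsubint hηS hηc
      obtain ⟨Cη, hCη⟩ := hη.continuous.bounded_above_of_compact_support hηc
      have hη0 : ∀ t ∉ Icc a' b', η t = 0 := fun t ht =>
        image_eq_zero_of_notMem_tsupport fun h' => ht (hKI h')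
      have hI := hFψ hIS hη.continuous.measurable hη0 hCη
      -- the space–time test function `θ(t, x) = η(t) ρ_n(c - x)`
      set θ : ℝ → E → ℝ := fun t x => η t * ρ n (c - x) with hθ
      have hρ' : ContDiff ℝ (⊤ : ℕ∞) fun x : E => ρ n (c - x) := (hρs n).comp (contDiff_const.sub contDiff_id)
      have hρ'c : HasCompactSupport fun x : E => ρ n (c - x) := (hρc n).comp_homeomorph (Homeomorph.subLeft c)
      have hθtest : IsSpaceTimeTestOn (slab E (Ioo T₁ T₂) isOpen_Ioo) θ :=
        BradshawTsai2019.isSpaceTimeTestOn_prod_mul isOpen_Ioo isOpen_univ hη hIS hη0 hρ' hρ'c (subset_univ _)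
      have hid := h θ hθtest e
      -- `∂ₑθ(t, x) = -η(t) ψ(x)`
      have hfd : ∀ z : ℝ × E, fderiv ℝ (θ z.1) z.2 e = -(η z.1 * ψ z.2) := by
        intro z
        show fderiv ℝ (fun x => η z.1 * ρ n (c - x)) z.2 e = _
        rw [fderiv_const_mul ((hρ'.differentiable (by simp)).differentiableAt), FunLike.coe_smul,
          Pi.smul_apply, fderiv_reflect_sub_apply (hρd n), smul_eq_mul]
        simp only [hψ]; ring
      have hid' : ∫ z in S ×ˢ (univ : Set E), η z.1 * (F z.1 z.2 * ψ z.2) = 0 := by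
        have e1 : ∫ z in S ×ˢ (univ : Set E), η z.1 * (F z.1 z.2 * ψ z.2) =
            -∫ z in S ×ˢ (univ : Set E), F z.1 z.2 * fderiv ℝ (θ z.1) z.2 e := by
          rw [← integral_neg]
          refine setIntegral_congr_fun (measurableSet_Ioo.prod MeasurableSet.univ) fun z _ => ?_
          rw [hfd z]; ring
        rw [e1, hid, neg_zero]
      -- back to the whole space and Fubini
      have hzero : ∀ z : ℝ × E, z ∉ S ×ˢ (univ : Set E) → η z.1 * (F z.1 z.2 * ψ z.2) = 0 := fun z hz => by
        have : z.1 ∉ Icc a' b' := fun h' => hz ⟨hIS h', mem_univ _⟩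
        rw [hη0 z.1 this, zero_mul]
      rw [setIntegral_eq_integral_of_forall_compl_eq_zero hzero, Measure.volume_eq_prod,
        integral_prod _ (by rw [← Measure.volume_eq_prod]; exact hI)] at hid'
      calc ∫ t, η t • g t = ∫ t, ∫ y, η t * (F t y * ψ y) := by
            refine integral_congr_ae (Eventually.of_forall fun t => ?_)
            simp only [hg, smul_eq_mul, ← integral_const_mul]
        _ = 0 := hid'
    filter_upwards [hdBR] with t ht htS using ht htS
  -- ## Step 2: all `(n, k, i)` at once, and local integrability of a.e. slice
  have hall : ∀ᵐ t ∂(volume : Measure ℝ), t ∈ S → ∀ (n k : ℕ) (i : Fin (Module.finrank ℝ E)),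
      ∫ y, F t y * fderiv ℝ (ρ n) (q k - y) (b i) = 0 := by
    have h1 : ∀ᵐ t ∂(volume : Measure ℝ), ∀ n k i, t ∈ S → ∫ y, F t y * fderiv ℝ (ρ n) (q k - y) (b i) = 0 := by
      refine ae_all_iff.2 fun n => ae_all_iff.2 fun k => ae_all_iff.2 fun i => hstep1 n (q k) (b i)
    filter_upwards [h1] with t ht htS n k i using ht n k i htS
  have hslice : ∀ᵐ t ∂(volume : Measure ℝ), t ∈ S → LocallyIntegrable (F t) (volume : Measure E) := by
    -- exhaust `S` by `J_l = [T₁ + 1/(l+1), T₂ - 1/(l+1)]` and `E` by the closed balls `B̄(0, m)`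
    have hJ : ∀ l : ℕ, Icc (T₁ + 1 / ((l : ℝ) + 1)) (T₂ - 1 / ((l : ℝ) + 1)) ⊆ S := fun l t ht =>
      ⟨by linarith [ht.1, (by positivity : (0 : ℝ) < 1 / ((l : ℝ) + 1))],
        by linarith [ht.2, (by positivity : (0 : ℝ) < 1 / ((l : ℝ) + 1))]⟩
    have hlm : ∀ (l m : ℕ), ∀ᵐ t ∂(volume : Measure ℝ), t ∈ Icc (T₁ + 1 / ((l : ℝ) + 1)) (T₂ - 1 / ((l : ℝ) + 1)) →
        IntegrableOn (F t) (closedBall (0 : E) m) volume := by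
      intro l m
      set J : Set ℝ := Icc (T₁ + 1 / ((l : ℝ) + 1)) (T₂ - 1 / ((l : ℝ) + 1)) with hJdef
      have hK : IsCompact (J ×ˢ closedBall (0 : E) m) := isCompact_Icc.prod (isCompact_closedBall _ _)
      have hI : IntegrableOn (uncurry F) (J ×ˢ closedBall (0 : E) m) volume :=
        hF.integrableOn_compact_subset (prod_mono (hJ l) (subset_univ _)) hK
      have hI' : Integrable (uncurry F) (((volume : Measure ℝ).restrict J).prod ((volume : Measure E).restrict (closedBall 0 m))) := by
        rw [Measure.prod_restrict, ← Measure.volume_eq_prod]; exact hI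
      have h2 := hI'.prod_right_ae
      rw [ae_restrict_iff' measurableSet_Icc] at h2
      filter_upwards [h2] with t ht htJ using ht htJ
    have hall' : ∀ᵐ t ∂(volume : Measure ℝ), ∀ l m : ℕ, t ∈ Icc (T₁ + 1 / ((l : ℝ) + 1)) (T₂ - 1 / ((l : ℝ) + 1)) →
        IntegrableOn (F t) (closedBall (0 : E) m) volume :=
      ae_all_iff.2 fun l => ae_all_iff.2 fun m => hlm l m
    filter_upwards [hall'] with t ht htS
    -- `t ∈ J_l` for some `l`
    obtain ⟨l, hl⟩ : ∃ l : ℕ, t ∈ Icc (T₁ + 1 / ((l : ℝ) + 1)) (T₂ - 1 / ((l : ℝ) + 1)) := by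
      have h1 : 0 < min (t - T₁) (T₂ - t) := lt_min (by linarith [htS.1]) (by linarith [htS.2])
      obtain ⟨l, hl⟩ := exists_nat_one_div_lt h1
      exact ⟨l, ⟨by linarith [hl, min_le_left (t - T₁) (T₂ - t)], by linarith [hl, min_le_right (t - T₁) (T₂ - t)]⟩⟩
    refine (locallyIntegrable_iff).2 fun K hK => ?_  -- `LocallyIntegrable f ↔ ∀ K compact, IntegrableOn f K`
    obtain ⟨r, hr⟩ := hK.isBounded.subset_closedBall (0 : E)
    obtain ⟨m, hm⟩ := exists_nat_ge r
    exact (ht l m hl).mono_set (hr.trans (closedBall_subset_closedBall hm))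
  -- ## Step 3–4: on a good slice the mollifications are constant and tend to the slice
  rw [ae_restrict_iff' measurableSet_Ioo]
  filter_upwards [hall, hslice] with t ht hloc htS
  have hid := ht htS
  have hf := hloc htS
  set f : E → ℝ := F t with hfdef
  -- the mollifications `G_n = f ⋆ ρ_n`
  set G : ℕ → E → ℝ := fun n => f ⋆[lsmul ℝ ℝ, (volume : Measure E)] ρ n with hGdef
  -- derivative along `e` at `c`: `∫ f(y) ∂ₑρ_n(c - y) dy`
  have hD : ∀ n (c e : E), HasFDerivAt (G n) ((f ⋆[(lsmul ℝ ℝ).precompR E, (volume : Measure E)] fderiv ℝ (ρ n)) c) c :=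
    fun n c e => (hρc n).hasFDerivAt_convolution_right (lsmul ℝ ℝ) hf ((hρs n).of_le (by simp)) c
  have hDapply : ∀ n (c e : E), (f ⋆[(lsmul ℝ ℝ).precompR E, (volume : Measure E)] fderiv ℝ (ρ n)) c e =
      ∫ y, f y * fderiv ℝ (ρ n) (c - y) e := by
    intro n c e
    rw [convolution_precompR_apply (L := lsmul ℝ ℝ) hf ((hρc n).fderiv (𝕜 := ℝ)) ((hρs n).continuous_fderiv (by simp)),
      convolution_def]
    simp only [lsmul_apply, smul_eq_mul]
  -- the pairing `c ↦ ∫ f(y) ∂ₑρ_n(c - y) dy` is continuous and vanishes on the dense sequence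
  have hΨ : ∀ n (i : Fin (Module.finrank ℝ E)) (c : E), ∫ y, f y * fderiv ℝ (ρ n) (c - y) (b i) = 0 := by
    intro n i
    have hcont : Continuous fun c : E => ∫ y, f y * fderiv ℝ (ρ n) (c - y) (b i) := by
      have h1 : Continuous (f ⋆[lsmul ℝ ℝ, (volume : Measure E)] fun a => fderiv ℝ (ρ n) a (b i)) :=
        (hDcs n (b i)).continuous_convolution_right (lsmul ℝ ℝ) hf (hDc n (b i))
      refine h1.congr fun c => ?_
      rw [convolution_def]; simp only [lsmul_apply, smul_eq_mul]
    have hdense : Dense (range q) := denseRange_denseSeq E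
    have hzero : ∀ k, (fun c : E => ∫ y, f y * fderiv ℝ (ρ n) (c - y) (b i)) (q k) = 0 := fun k => hid n k i
    intro c
    have hcl : IsClosed {c : E | ∫ y, f y * fderiv ℝ (ρ n) (c - y) (b i) = 0} :=
      isClosed_eq hcont continuous_const
    have hsub : range q ⊆ {c : E | ∫ y, f y * fderiv ℝ (ρ n) (c - y) (b i) = 0} := by
      rintro _ ⟨k, rfl⟩; exact hzero k
    have hc : c ∈ closure {c : E | ∫ y, f y * fderiv ℝ (ρ n) (c - y) (b i) = 0} := by
      rw [(hdense.mono hsub).closure_eq]; exact mem_univ c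
    rw [hcl.closure_eq] at hc
    exact hc
  -- hence `∇G_n = 0` and `G_n` is constant
  have hGconst : ∀ n (c : E), G n c = G n 0 := by
    intro n
    have hdiff : Differentiable ℝ (G n) := fun c => (hD n c 0).differentiableAt
    have hfd0 : ∀ c, fderiv ℝ (G n) c = 0 := by
      intro c
      rw [(hD n c 0).fderiv]
      refine ContinuousLinearMap.ext fun v => ?_
      rw [zero_apply]
      -- expand `v` in the basis
      have hv : v = ∑ i, ⟪b i, v⟫ • b i := (b.sum_repr' v).symm
      rw [hv, map_sum]
      refine Finset.sum_eq_zero fun i _ => ?_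
      rw [map_smul, hDapply, hΨ n i c, smul_zero]
    exact fun c => is_const_of_fderiv_eq_zero hdiff hfd0 c 0
  -- ## Step 4: `ρ_n ⋆ f → f` a.e., and `ρ_n ⋆ f = f ⋆ ρ_n = G_n 0`
  have hswap : ∀ n (x : E), ((φ n).normed (volume : Measure E) ⋆[lsmul ℝ ℝ, (volume : Measure E)] f) x = G n x := by
    intro n x
    show ((φ n).normed volume ⋆[lsmul ℝ ℝ, volume] f) x = (f ⋆[lsmul ℝ ℝ, volume] ρ n) x
    rw [convolution_eq_swap, convolution_def]
    simp only [lsmul_apply, smul_eq_mul]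
    refine integral_congr_ae (Eventually.of_forall fun y => ?_)
    show (φ n).normed volume (x - y) * f y = f y * ρ n (x - y)
    rw [mul_comm]
  have hae : ∀ᵐ x ∂(volume : Measure E), Tendsto (fun n => ((φ n).normed (volume : Measure E) ⋆[lsmul ℝ ℝ, (volume : Measure E)] f) x)
      atTop (𝓝 (f x)) :=
    ContDiffBump.ae_convolution_tendsto_right_of_locallyIntegrable hφ0 (Eventually.of_forall hφ2) hf
  refine ⟨limUnder atTop fun n => G n 0, ?_⟩
  filter_upwards [hae] with x hx
  have hx' : Tendsto (fun n => G n 0) atTop (𝓝 (f x)) := by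
    refine hx.congr fun n => ?_
    rw [hswap n x, hGconst n x]
  exact (hx'.limUnder_eq).symm

/-- **A distributional pressure is determined up to a function of time**: if `F` is locally
integrable on the slab `(T₁,T₂) × E` and `∫∫ F div ψ = 0` for every vector space–time test
field `ψ` on the slab (the difference of two pressures solving the distributional Navier–Stokes
equations with the same velocity satisfies this), then for a.e. `t`, `F(t,·)` is a.e. constant
(Rusin–Šverák 2011, §2 p. 4; Jia–Šverák 2014, §3 (3.3): the pressure of a Leray solution near
`x₀` is given "for some constant `c_{x₀,R}(t)`"). [cite: JiaSverak2014, §3 (3.3)] [cite: RusinSverak2011, §2 p. 4] -/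
theorem ae_exists_const_of_forall_integral_mul_divergence_eq_zero {T₁ T₂ : ℝ} {F : ℝ → E → ℝ}
    (hF : LocallyIntegrableOn (uncurry F) (Ioo T₁ T₂ ×ˢ (univ : Set E)) volume)
    (h : ∀ ψ : ℝ → E → E, IsSpaceTimeTestOn (slab E (Ioo T₁ T₂) isOpen_Ioo) ψ →
      ∫ z in Ioo T₁ T₂ ×ˢ (univ : Set E), F z.1 z.2 * VectorCalculus.divergence (ψ z.1) z.2 = 0) :
    ∀ᵐ t ∂(volume.restrict (Ioo T₁ T₂)), ∃ κ : ℝ, ∀ᵐ x ∂(volume : Measure E), F t x = κ := by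
  refine ae_exists_const_of_forall_integral_mul_fderiv_eq_zero hF fun θ hθ e => ?_
  -- the vector test field `ψ = θ e`
  have hψ : IsSpaceTimeTestOn (slab E (Ioo T₁ T₂) isOpen_Ioo) fun t x => θ t x • e :=
    hθ.smul_field (e := fun _ _ => e) contDiff_const
  rw [← h _ hψ]
  refine setIntegral_congr_fun (measurableSet_Ioo.prod MeasurableSet.univ) fun z _ => ?_
  rw [divergence_smul_const_eq_fderiv_apply (((hθ.contDiff_slice z.1).differentiable (by simp)).differentiableAt) e]

/-- **A measurable gauge**: under the hypotheses of
`ae_exists_const_of_forall_integral_mul_divergence_eq_zero` there is a measurable `c : ℝ → ℝ`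
with `F(t, x) = c(t)` for a.e. `x`, for a.e. `t ∈ (T₁,T₂)` (take `c(t) = ⨍_{B(0,1)} F(t,·)`,
measurable by Fubini, modified on a null set). [cite: JiaSverak2014, §3 (3.3)] -/
theorem exists_measurable_gauge_of_forall_integral_mul_divergence_eq_zero {T₁ T₂ : ℝ} {F : ℝ → E → ℝ}
    (hF : LocallyIntegrableOn (uncurry F) (Ioo T₁ T₂ ×ˢ (univ : Set E)) volume)
    (h : ∀ ψ : ℝ → E → E, IsSpaceTimeTestOn (slab E (Ioo T₁ T₂) isOpen_Ioo) ψ →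
      ∫ z in Ioo T₁ T₂ ×ˢ (univ : Set E), F z.1 z.2 * VectorCalculus.divergence (ψ z.1) z.2 = 0) :
    ∃ c : ℝ → ℝ, Measurable c ∧
      ∀ᵐ t ∂(volume.restrict (Ioo T₁ T₂)), ∀ᵐ x ∂(volume : Measure E), F t x = c t := by
  haveI : Nonempty E := ⟨0⟩
  have hae := ae_exists_const_of_forall_integral_mul_divergence_eq_zero hF h
  -- the ball mean
  set B : Set E := ball (0 : E) 1 with hB
  have hB0 : (volume : Measure E) B ≠ 0 := (measure_ball_pos volume (0 : E) one_pos).ne'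
  have hBt : (volume : Measure E) B ≠ ⊤ := measure_ball_lt_top.ne
  set c₀ : ℝ → ℝ := fun t => ⨍ x in B, F t x with hc₀
  have hc₀κ : ∀ᵐ t ∂(volume.restrict (Ioo T₁ T₂)), ∀ᵐ x ∂(volume : Measure E), F t x = c₀ t := by
    filter_upwards [hae] with t ht
    obtain ⟨κ, hκ⟩ := ht
    have hct : c₀ t = κ := by
      have hκ' : (fun x => F t x) =ᵐ[(volume : Measure E).restrict B] fun _ => κ := ae_restrict_of_ae hκ
      show ⨍ x, F t x ∂((volume : Measure E).restrict B) = κ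
      rw [average_congr hκ']
      exact setAverage_const hB0 hBt κ
    rw [hct]; exact hκ
  -- measurability: a measurable modification of `c₀` on `(T₁, T₂)`
  have hc₀m : AEMeasurable c₀ (volume.restrict (Ioo T₁ T₂)) := by
    -- exhaust by compact subintervals where `F` is integrable on `J × B̄`
    have hJ : ∀ l : ℕ, Icc (T₁ + 1 / ((l : ℝ) + 1)) (T₂ - 1 / ((l : ℝ) + 1)) ⊆ Ioo T₁ T₂ := fun l t ht =>
      ⟨by linarith [ht.1, (by positivity : (0 : ℝ) < 1 / ((l : ℝ) + 1))],
        by linarith [ht.2, (by positivity : (0 : ℝ) < 1 / ((l : ℝ) + 1))]⟩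
    have hU : (⋃ l : ℕ, Icc (T₁ + 1 / ((l : ℝ) + 1)) (T₂ - 1 / ((l : ℝ) + 1))) = Ioo T₁ T₂ := by
      refine Subset.antisymm (iUnion_subset hJ) fun t ht => ?_
      have h1 : 0 < min (t - T₁) (T₂ - t) := lt_min (by linarith [ht.1]) (by linarith [ht.2])
      obtain ⟨l, hl⟩ := exists_nat_one_div_lt h1
      exact mem_iUnion.2 ⟨l, ⟨by linarith [hl, min_le_left (t - T₁) (T₂ - t)],
        by linarith [hl, min_le_right (t - T₁) (T₂ - t)]⟩⟩
    rw [← hU]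
    refine (aemeasurable_iUnion_iff).2 fun l => ?_
    set J : Set ℝ := Icc (T₁ + 1 / ((l : ℝ) + 1)) (T₂ - 1 / ((l : ℝ) + 1)) with hJdef
    have hK : IsCompact (J ×ˢ closedBall (0 : E) 1) := isCompact_Icc.prod (isCompact_closedBall _ _)
    have hI : IntegrableOn (uncurry F) (J ×ˢ closedBall (0 : E) 1) volume :=
      hF.integrableOn_compact_subset (prod_mono (hJ l) (subset_univ _)) hK
    have hI' : Integrable (uncurry F) (((volume : Measure ℝ).restrict J).prod ((volume : Measure E).restrict B)) := by
      rw [Measure.prod_restrict, ← Measure.volume_eq_prod]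
      exact hI.mono_set (prod_mono Subset.rfl ball_subset_closedBall)
    have h1 : AEStronglyMeasurable (fun t => ∫ x in B, F t x) ((volume : Measure ℝ).restrict J) :=
      hI'.aestronglyMeasurable.integral_prod_right'
    have h2 : c₀ = fun t => ((volume : Measure E).real B)⁻¹ • ∫ x in B, F t x := by
      funext t; rw [hc₀]; exact setAverage_eq _ _ _
    rw [h2]
    exact (h1.const_smul (((volume : Measure E).real B)⁻¹)).aemeasurable
  refine ⟨hc₀m.mk c₀, hc₀m.measurable_mk, ?_⟩
  filter_upwards [hc₀κ, hc₀m.ae_eq_mk] with t ht htc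
  rw [← htc]; exact ht

end Literature.Analysis.FluidPDE

end
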